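import Literature.NumberTheory.Transcendental.QuadraticRelationsLogarithmsResultant
import Mathlib.Analysis.SpecialFunctions.Pow.Real
import HarnessLib

/-!
# Roy–Waldschmidt 1997, Proposition 3.5

Third brick of §3 of D. Roy, M. Waldschmidt, *Approximation diophantienne et indépendance
algébrique de logarithmes*, Ann. Sci. ÉNS (4) 30 (1997), towards their approximation theorem
(Théorème 3.2), an ingredient of the proof of their Théorème 1.1 (corollary Théorème 0.2 = the
tree's named fact `Literature.NumberTheory.Transcendental.royWaldschmidt_quadratic_thm_0_2`).

**Proposition 3.5** (p. 766). Let `θ ∈ ℂ`, `F, G ∈ ℂ[X]` non-constant, `m, n` positive integers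
bounding the degrees of `F`, `G`, `ρ` the distance from `θ` to the roots of `F` and `G`, and
assume the leading coefficients of `F`, `G` have absolute value `≥ 1`. Then for every integer
`s > 0`, `min{1, ρ}^{s²/4} |R(F,G)| ≤ 2^{mn} M(F)^n M(G)^m max{|F(θ)|, |G(θ)|}^s` (3.7).

PROVED as `RoyWaldschmidt1997.prop_3_5` (for all `s ≥ 0`, any non-negative lower bound `ρ` of the
distances, `F, G ≠ 0`).  Proof as printed: for `s ≤ deg F + deg G`, apply Lemme 3.4
(`resultant_wirsing`) to the `s` roots closest to `θ` (chosen greedily,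
`exists_closest_roots`), so that `f + g = s`, `fg ≤ s²/4`; the paper's perturbation argument
("on peut approcher `F` et `G` … par continuité") is not needed thanks to the sub-multiset form of
Lemme 3.4.  For `s = deg F + deg G + k`, use `min{1,ρ}^{deg F} ≤ |F(θ)|`,
`min{1,ρ}^{deg G} ≤ |G(θ)|`.  No definitions, no named facts.

## References

* [RoyWaldschmidt1997ENS] D. Roy, M. Waldschmidt, Ann. Sci. ÉNS (4) 30 (1997) 753–796, §3 (ii)
  Proposition 3.5, pp. 766–767 (lit key paper:doi-10-1016-s0012-9593-97-89938-7, PDF pp. 15–16).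
-/

noncomputable section

open Polynomial Multiset

namespace Literature.NumberTheory.Transcendental

namespace RoyWaldschmidt1997

/-! ### Choosing the closest roots -/

/-- **Greedy choice of the `k` smallest elements across two multisets.** For `k ≤ |S| + |T|`
there are decompositions `S = A + A'`, `T = B + B'` with `|A| + |B| = k` and `p x ≤ p y` for all
chosen `x ∈ A + B` and unchosen `y ∈ A' + B'`. [folklore] -/
theorem exists_smallest {ι : Type*} [DecidableEq ι] (S T : Multiset ι) (p : ι → ℝ) :
    ∀ k ≤ card S + card T, ∃ A A' B B' : Multiset ι, S = A + A' ∧ T = B + B' ∧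
      card A + card B = k ∧ ∀ x ∈ A + B, ∀ y ∈ A' + B', p x ≤ p y := by
  intro k
  induction k with
  | zero =>
    intro _
    exact ⟨0, S, 0, T, by simp, by simp, by simp, fun x hx => by simp at hx⟩
  | succ k ih =>
    intro hk
    obtain ⟨A, A', B, B', hS, hT, hcard, hord⟩ := ih (Nat.le_of_succ_le hk)
    -- an unchosen element of minimal `p`
    have hne : A' + B' ≠ 0 := by
      intro h0
      have h1 : card (A' + B') = 0 := by rw [h0, card_zero]
      rw [card_add] at h1
      have := congrArg card hS; have := congrArg card hT
      rw [card_add] at *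
      omega
    obtain ⟨γ, hγmem, hγmin⟩ := Finset.exists_min_image (A' + B').toFinset p
      (by obtain ⟨z, hz⟩ := Multiset.exists_mem_of_ne_zero hne; exact ⟨z, Multiset.mem_toFinset.mpr hz⟩)
    rw [Multiset.mem_toFinset] at hγmem
    have hmin : ∀ y ∈ A' + B', p γ ≤ p y := fun y hy => hγmin y (Multiset.mem_toFinset.mpr hy)
    -- chosen elements are `≤ γ ≤` unchosen ones
    have hγge : ∀ x ∈ A + B, p x ≤ p γ := fun x hx => hord x hx γ hγmem
    rcases Multiset.mem_add.mp hγmem with hγA' | hγB'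
    · obtain ⟨A'', hA''⟩ := Multiset.exists_cons_of_mem hγA'
      refine ⟨γ ::ₘ A, A'', B, B', ?_, hT, ?_, ?_⟩
      · rw [hS, hA'']; simp [add_comm]
      · rw [card_cons]; omega
      · intro x hx y hy
        have hy' : y ∈ A' + B' := by
          rw [hA'']; rcases Multiset.mem_add.mp hy with h | h
          · exact Multiset.mem_add.mpr (Or.inl (Multiset.mem_cons_of_mem h))
          · exact Multiset.mem_add.mpr (Or.inr h)
        rw [Multiset.cons_add] at hx
        rcases Multiset.mem_cons.mp hx with rfl | hx
        · exact hmin y hy'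
        · exact (hγge x hx).trans (hmin y hy')
    · obtain ⟨B'', hB''⟩ := Multiset.exists_cons_of_mem hγB'
      refine ⟨A, A', γ ::ₘ B, B'', hS, ?_, ?_, ?_⟩
      · rw [hT, hB'']; simp [add_comm]
      · rw [card_cons]; omega
      · intro x hx y hy
        have hy' : y ∈ A' + B' := by
          rw [hB'']; rcases Multiset.mem_add.mp hy with h | h
          · exact Multiset.mem_add.mpr (Or.inl h)
          · exact Multiset.mem_add.mpr (Or.inr (Multiset.mem_cons_of_mem h))
        rw [Multiset.add_cons] at hx
        rcases Multiset.mem_cons.mp hx with rfl | hx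
        · exact hmin y hy'
        · exact (hγge x hx).trans (hmin y hy')

/-! ### Proposition 3.5 -/

/-- `min(1, ρ)^{deg F} ≤ |F(θ)|` when `|lc F| ≥ 1` and `ρ` bounds the distances from `θ` to the
roots from below ("L'hypothèse sur les coefficients dominants … implique aussi `ρ^m ≤ |F(θ)|`",
p. 767). [cite: RoyWaldschmidt1997ENS, §3 (ii) proof of Proposition 3.5, p. 767] -/
theorem min_one_pow_le_norm_eval (F : ℂ[X]) (hFa : 1 ≤ ‖F.leadingCoeff‖) (θ : ℂ) (ρ : ℝ)
    (hρ : 0 ≤ ρ) (hρF : ∀ α ∈ F.roots, ρ ≤ ‖θ - α‖) :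
    (min 1 ρ) ^ F.natDegree ≤ ‖F.eval θ‖ := by
  rw [norm_eval_eq_prod_roots, ← card_roots_eq F]
  have h1 : (min 1 ρ) ^ card F.roots ≤ (F.roots.map fun α => ‖θ - α‖).prod := by
    have : (min 1 ρ) ^ card F.roots = (F.roots.map fun _ => min 1 ρ).prod := (prod_map_const' _ _).symm
    rw [this]
    exact prod_map_le_prod_map' _ (fun _ _ => le_min zero_le_one hρ)
      fun α hα => (min_le_right _ _).trans (hρF α hα)
  calc (min 1 ρ) ^ card F.roots ≤ (F.roots.map fun α => ‖θ - α‖).prod := h1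
    _ = 1 * _ := (one_mul _).symm
    _ ≤ ‖F.leadingCoeff‖ * (F.roots.map fun α => ‖θ - α‖).prod :=
        mul_le_mul_of_nonneg_right hFa (prod_map_nonneg _ fun _ _ => norm_nonneg _)

/-- **Roy–Waldschmidt 1997, Proposition 3.5.**  Let `F, G ∈ ℂ[X]` be non-zero with leading
coefficients of absolute value `≥ 1`, `m ≥ deg F`, `n ≥ deg G`, `θ ∈ ℂ`, and `0 ≤ ρ` a lower
bound for the distances from `θ` to the roots of `F` and `G` (e.g. that distance). Then for every
`s`, `min{1,ρ}^{s²/4} |Res(F,G)| ≤ 2^{mn} M(F)^n M(G)^m max{|F(θ)|,|G(θ)|}^s`.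
[cite: RoyWaldschmidt1997ENS, §3 (ii) Proposition 3.5 (3.7), pp. 766–767] -/
theorem prop_3_5 (F G : ℂ[X]) (hF : F ≠ 0) (hG : G ≠ 0) (hFa : 1 ≤ ‖F.leadingCoeff‖)
    (hGb : 1 ≤ ‖G.leadingCoeff‖) (θ : ℂ) {m n : ℕ} (hm : F.natDegree ≤ m) (hn : G.natDegree ≤ n)
    (ρ : ℝ) (hρ : 0 ≤ ρ) (hρF : ∀ α ∈ F.roots, ρ ≤ ‖θ - α‖) (hρG : ∀ β ∈ G.roots, ρ ≤ ‖θ - β‖)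
    (s : ℕ) :
    (min 1 ρ) ^ ((s : ℝ) ^ 2 / 4) * ‖resultant F G‖ ≤
      2 ^ (m * n) * F.mahlerMeasure ^ n * G.mahlerMeasure ^ m * (max ‖F.eval θ‖ ‖G.eval θ‖) ^ s := by
  classical
  set μ := min 1 ρ with hμ
  have hμ0 : 0 ≤ μ := le_min zero_le_one hρ
  have hμ1 : μ ≤ 1 := min_le_left _ _
  have hμρ : μ ≤ ρ := min_le_right _ _
  set m₀ := F.natDegree with hm₀
  set n₀ := G.natDegree with hn₀
  have hMF : 1 ≤ F.mahlerMeasure := one_le_mahlerMeasure_of_one_le_norm_leadingCoeff hFa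
  have hMG : 1 ≤ G.mahlerMeasure := one_le_mahlerMeasure_of_one_le_norm_leadingCoeff hGb
  set X := max ‖F.eval θ‖ ‖G.eval θ‖ with hX
  have hX0 : 0 ≤ X := le_max_of_le_left (norm_nonneg _)
  -- the case `s ≤ deg F + deg G`
  have caseA : ∀ s ≤ m₀ + n₀, μ ^ ((s : ℝ) ^ 2 / 4) * ‖resultant F G‖ ≤
      2 ^ (m * n) * F.mahlerMeasure ^ n * G.mahlerMeasure ^ m * X ^ s := by
    intro s hs
    obtain ⟨A, A', B, B', hSA, hTB, hcard, hord⟩ :=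
      exists_smallest F.roots G.roots (fun z => ‖θ - z‖) s (by rwa [card_roots_eq, card_roots_eq])
    have hA : A ≤ F.roots := hSA ▸ Multiset.le_add_right _ _
    have hB : B ≤ G.roots := hTB ▸ Multiset.le_add_right _ _
    have hA' : F.roots - A = A' := by rw [hSA, add_tsub_cancel_left]
    have hB' : G.roots - B = B' := by rw [hTB, add_tsub_cancel_left]
    have h34 := resultant_wirsing F G hF hG θ A B hA hB ρ hρ hρF hρG
      (fun α hα β hβ => hord α (Multiset.mem_add.mpr (Or.inl hα)) β
        (Multiset.mem_add.mpr (Or.inr (hB' ▸ hβ))))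
      (fun β hβ α hα => hord β (Multiset.mem_add.mpr (Or.inr hβ)) α
        (Multiset.mem_add.mpr (Or.inl (hA' ▸ hα))))
    set f := card A with hf
    set g := card B with hg
    have hfm : f ≤ m₀ := by
      have := Multiset.card_le_card hA; rwa [card_roots_eq] at this
    have hgn : g ≤ n₀ := by
      have := Multiset.card_le_card hB; rwa [card_roots_eq] at this
    -- `μ^{s²/4} ≤ ρ^{fg}`
    have hexp : ((f * g : ℕ) : ℝ) ≤ (s : ℝ) ^ 2 / 4 := by
      have : (4 : ℝ) * (f * g : ℕ) ≤ (s : ℝ) ^ 2 := by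
        rw [← hcard]; push_cast; nlinarith [sq_nonneg ((f : ℝ) - g)]
      linarith
    have hμle : μ ^ ((s : ℝ) ^ 2 / 4) ≤ ρ ^ (f * g) := by
      calc μ ^ ((s : ℝ) ^ 2 / 4) ≤ μ ^ ((f * g : ℕ) : ℝ) :=
            Real.rpow_le_rpow_of_exponent_ge' hμ0 hμ1 (by positivity) hexp
        _ = μ ^ (f * g) := Real.rpow_natCast _ _
        _ ≤ ρ ^ (f * g) := pow_le_pow_left₀ hμ0 hμρ _
    -- the right-hand side
    have hrhs : 2 ^ (m₀ * n₀) * F.mahlerMeasure ^ (n₀ - g) * G.mahlerMeasure ^ (m₀ - f) *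
        ‖F.eval θ‖ ^ g * ‖G.eval θ‖ ^ f ≤
        2 ^ (m * n) * F.mahlerMeasure ^ n * G.mahlerMeasure ^ m * X ^ s := by
      have h2 : (2 : ℝ) ^ (m₀ * n₀) ≤ 2 ^ (m * n) :=
        pow_le_pow_right₀ (by norm_num) (Nat.mul_le_mul hm hn)
      have h3 : F.mahlerMeasure ^ (n₀ - g) ≤ F.mahlerMeasure ^ n :=
        pow_le_pow_right₀ hMF ((Nat.sub_le _ _).trans hn)
      have h4 : G.mahlerMeasure ^ (m₀ - f) ≤ G.mahlerMeasure ^ m :=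
        pow_le_pow_right₀ hMG ((Nat.sub_le _ _).trans hm)
      have h5 : ‖F.eval θ‖ ^ g * ‖G.eval θ‖ ^ f ≤ X ^ s := by
        rw [← hcard, add_comm, pow_add]
        exact mul_le_mul (pow_le_pow_left₀ (norm_nonneg _) (le_max_left _ _) _)
          (pow_le_pow_left₀ (norm_nonneg _) (le_max_right _ _) _) (by positivity) (by positivity)
      calc 2 ^ (m₀ * n₀) * F.mahlerMeasure ^ (n₀ - g) * G.mahlerMeasure ^ (m₀ - f) *
            ‖F.eval θ‖ ^ g * ‖G.eval θ‖ ^ f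
          = 2 ^ (m₀ * n₀) * F.mahlerMeasure ^ (n₀ - g) * G.mahlerMeasure ^ (m₀ - f) *
            (‖F.eval θ‖ ^ g * ‖G.eval θ‖ ^ f) := by ring
        _ ≤ 2 ^ (m * n) * F.mahlerMeasure ^ n * G.mahlerMeasure ^ m * X ^ s := by
            gcongr
    calc μ ^ ((s : ℝ) ^ 2 / 4) * ‖resultant F G‖ ≤ ρ ^ (f * g) * ‖resultant F G‖ :=
          mul_le_mul_of_nonneg_right hμle (norm_nonneg _)
      _ ≤ _ := h34
      _ ≤ _ := hrhs
  by_cases hs : s ≤ m₀ + n₀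
  · exact caseA s hs
  · -- `s = (deg F + deg G) + k`: `μ^{s²/4} ≤ μ^{s₀²/4} μ^{s₀ k/2}` and `μ^{s₀/2} ≤ X`
    push Not at hs
    obtain ⟨k, rfl⟩ := Nat.exists_eq_add_of_lt hs
    set s₀ := m₀ + n₀ with hs₀
    have hA := caseA s₀ le_rfl
    have hres0 : 0 ≤ ‖resultant F G‖ := norm_nonneg _
    -- `μ^{s₀} ≤ X²`
    have hμF : μ ^ m₀ ≤ ‖F.eval θ‖ := min_one_pow_le_norm_eval F hFa θ ρ hρ hρF
    have hμG : μ ^ n₀ ≤ ‖G.eval θ‖ := min_one_pow_le_norm_eval G hGb θ ρ hρ hρG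
    have hμX : μ ^ s₀ ≤ X ^ 2 := by
      rw [hs₀, pow_add, sq]
      exact mul_le_mul (hμF.trans (le_max_left _ _)) (hμG.trans (le_max_right _ _))
        (pow_nonneg hμ0 _) hX0
    -- hence `μ^{s₀ (k+1) / 2} ≤ X^{k+1}`
    have hμXk : μ ^ ((s₀ : ℝ) * (k + 1) / 2) ≤ X ^ (k + 1) := by
      have h1 : μ ^ ((s₀ : ℝ) * (k + 1) / 2) = (μ ^ ((s₀ : ℝ) / 2)) ^ ((k : ℝ) + 1) := by
        rw [← Real.rpow_mul hμ0]; congr 1; ring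
      have h2 : μ ^ ((s₀ : ℝ) / 2) ≤ X := by
        have h3 : (μ ^ ((s₀ : ℝ) / 2)) ^ (2 : ℝ) ≤ X ^ (2 : ℝ) := by
          rw [← Real.rpow_mul hμ0, show (s₀ : ℝ) / 2 * 2 = (s₀ : ℕ) from by ring, Real.rpow_natCast,
            show (2 : ℝ) = (2 : ℕ) from by norm_num, Real.rpow_natCast]
          exact hμX
        exact le_of_pow_le_pow_left₀ two_ne_zero hX0 (by
          have := h3
          rw [show (2 : ℝ) = (2 : ℕ) from by norm_num, Real.rpow_natCast, Real.rpow_natCast] at this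
          exact this)
      rw [h1, show ((k : ℝ) + 1) = ((k + 1 : ℕ) : ℝ) from by push_cast; ring, Real.rpow_natCast]
      exact pow_le_pow_left₀ (Real.rpow_nonneg hμ0 _) h2 _
    -- `μ^{s²/4} ≤ μ^{s₀²/4} · μ^{s₀(k+1)/2}`
    have hsplit : μ ^ (((s₀ + (k + 1) : ℕ) : ℝ) ^ 2 / 4) ≤
        μ ^ ((s₀ : ℝ) ^ 2 / 4) * μ ^ ((s₀ : ℝ) * (k + 1) / 2) := by
      rcases eq_or_lt_of_le hμ0 with hμz | hμpos
      · -- `μ = 0`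
        rw [← hμz]
        have hpos : (0 : ℝ) < ((s₀ + (k + 1) : ℕ) : ℝ) ^ 2 / 4 := by positivity
        rw [Real.zero_rpow hpos.ne']
        exact mul_nonneg (Real.rpow_nonneg le_rfl _) (Real.rpow_nonneg le_rfl _)
      · rw [← Real.rpow_add hμpos]
        refine Real.rpow_le_rpow_of_exponent_ge hμpos hμ1 ?_
        push_cast
        nlinarith [sq_nonneg ((k : ℝ) + 1)]
    calc μ ^ (((s₀ + (k + 1) : ℕ) : ℝ) ^ 2 / 4) * ‖resultant F G‖
        ≤ (μ ^ ((s₀ : ℝ) ^ 2 / 4) * μ ^ ((s₀ : ℝ) * (k + 1) / 2)) * ‖resultant F G‖ :=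
          mul_le_mul_of_nonneg_right hsplit hres0
      _ = μ ^ ((s₀ : ℝ) * (k + 1) / 2) * (μ ^ ((s₀ : ℝ) ^ 2 / 4) * ‖resultant F G‖) := by ring
      _ ≤ X ^ (k + 1) * (2 ^ (m * n) * F.mahlerMeasure ^ n * G.mahlerMeasure ^ m * X ^ s₀) :=
          mul_le_mul hμXk hA (mul_nonneg (Real.rpow_nonneg hμ0 _) hres0) (pow_nonneg hX0 _)
      _ = 2 ^ (m * n) * F.mahlerMeasure ^ n * G.mahlerMeasure ^ m * X ^ (s₀ + (k + 1)) := by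
          rw [pow_add]; ring

end RoyWaldschmidt1997

end Literature.NumberTheory.Transcendental
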